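/-
COR-CM (cell pub-hodgecm2 = stage 2 of the Hodge ladder), seat b27 gen 16 (prover-pub-hodgecm2-b27-g16-0, 2026-08-21);
count-neutral for the binder table (no row).  Lane VAC-C (CONCLUSION side) of the kernel evidence for the coordinator's
VACUITY/MODEL audit (operator priority5, 2026-08-21T02:09:59Z; t0 probe `run/shared/lean/pub/hodge-director/
audit-vacuity/t0.json`): disjoint from p1's `Assembly/CarrierNonVacuity` (carrier / binder prefix / type display,
RULING VAC-LANES), b02's `HodgeTheory/AbelianVarietyHodgeFullnessNonVacuity` (record B02) and b14's
`Geometry/PeriodNonDegenerate` (hypothesis `PerLFace`).  Theorems only: no definition, no named fact, no instance;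
the existence record is CONSUMED as the term `cmAbelianVarietyRealised_of_riemann deligneMilne1982_Thm_6_20_full_holds
deligneMilne1982_Thm_6_20_essImage_holds` (RULING E-DEDUP), never re-declared.
-/
import Summits.HodgeConjecture.CorCM.Interfaces
import Summits.HodgeConjecture.CorCM.Geometry.RiemannEssentialImage
import Literature.AlgebraicGeometry.ComplexMultiplication.CMAbelianVarietyRealisedOfRiemann
import Literature.AlgebraicGeometry.Pohlmann1968.DegenerateCMTypeCyclotomic21
import Literature.AlgebraicGeometry.Pohlmann1968.DegenerateCMTypesRibetLenstraSerre
import Literature.AlgebraicGeometry.Milne1999.CodesHCOfCMHodgeHypothesis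
import Literature.AlgebraicGeometry.HodgeTheory.AbelianVarietyHodgeFullnessHolds
import Literature.AlgebraicGeometry.HodgeTheory.HodgeTypeVanishing
import Literature.AlgebraicGeometry.HodgeTheory.HodgeTypeConjugation
import Literature.AlgebraicGeometry.HodgeTheory.AbelJacobiPullbackHodgeSection
import Literature.AlgebraicGeometry.HodgeTheory.AlgebraicClassesHodgeTypeHolds
import Literature.AlgebraicGeometry.Deligne1982.CMTypeRosatiPolarization
import Literature.AlgebraicGeometry.Pohlmann1968.HodgeClassesCMType
import Literature.AlgebraicGeometry.Motives.VarietiesDimensionProofs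
import Literature.NumberTheory.Automorphic.PicardCMEigenbasis
import HarnessLib

/-!
# `HC_CM` has content at inhabited binder values: exceptional Hodge classes (kernel witnesses, hypothesis-free)

The stage-2 target `HC_CM := RankFourFaces.CMAbelianHodge` (item `stmt-HodgeConjecture-3052`) reads
`∀ A : AbelianVariety ℂ, IsSmoothProjective A.dim A.X → IsOfCMType A → HodgeConjectureFor A.dim A.X`, and the cycle
clause of `HodgeConjectureFor n X` quantifies over the rational classes `c ∈ H²ᵖ(X(ℂ); ℂ)` of Hodge type `(p,p)`.
A carrier that is inhabited, but only by binder values whose Hodge classes are all products of divisor classes,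
would still make `HC_CM` «true for a cheap reason» (Lefschetz `(1,1)` and cup products).  This file certifies in the
kernel, with NO hypothesis, that the binder of `HC_CM` takes values — abelian varieties `A` meeting BOTH hypotheses
`IsSmoothProjective A.dim A.X` and `IsOfCMType A` VERBATIM — carrying rational `(p,p)`-classes OUTSIDE the span
`divisorClassesSpan` of products of `p` divisor classes (`Bᵖ(A) ≠ Dᵖ(A)`), already in codimension `p = 2`:

* `exists_hc_cm_binders_exceptional_codim_two` — a SIMPLE abelian `8`-fold of CM type (Lenstra's degenerate type
  `Φ′` on `ℚ(ζ₃₂)`, lit-pohlmann's `Pohlmann1968/DegenerateCMTypesRibetLenstraSerre`) with a rational `(2,2)`-class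
  outside `D²`;
* `exists_hc_cm_binders_exceptional_codim_three` — a SIMPLE abelian `6`-fold of CM type (the primitive degenerate
  type `Φ₂₁` on `ℚ(ζ₂₁)`, `Pohlmann1968/DegenerateCMTypeCyclotomic21`) with a rational `(3,3)`-class outside `D³`;
* `hc_cm_consequence_codim_two`, `hc_cm_consequence_codim_three` — what `HC_CM` ASSERTS there: those classes lie in
  `algebraicClasses A.X p` (the span of classes of codimension-`p` algebraic cycles).  Nothing is claimed about the
  truth of these consequences; they record that the target's conclusion is not discharged by divisors at inhabited
  binder values (algebraicity of such Weil-type classes on these CM points is open in print to the typist's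
  knowledge: van Geemen 1994 §4, Gordon 1999 §9.4).

The abelian varieties EXIST by Riemann's theorem (Shimura 1998 §6.2 Thm. 3 as the tree theorem
`cmAbelianVarietyRealised_of_riemann` at `deligneMilne1982_Thm_6_20_full_holds` and
`deligneMilne1982_Thm_6_20_essImage_holds` — the same term as in `Assembly/ExceptionalHodgeClassesHold`, whose
barrier-shaped statements do not display the binder `IsOfCMType A`; here both binders of `HC_CM` are displayed
literally and `HC_CM` is applied to them).

## References

* [Pohlmann1968] H. Pohlmann, Ann. of Math. (2) 88 (1968) 161–180, Thm. 1 and §3.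
* [vanGeemen1994HodgeAV] B. van Geemen, LNM 1594 (1994), Thm. 4.5, 4.7, §4.
* [Gordon1999HodgeAVSurvey] B. B. Gordon, *A survey of the Hodge conjecture for abelian varieties* (1999), 5.13 (ii),
  §9.4.2.
* [Shimura1998] G. Shimura, *Abelian Varieties with Complex Multiplication and Modular Functions* (1998), §6.2 Thm. 3,
  §8.2 Prop. 26.
* [Milne1999] J. S. Milne, Compositio Math. 117 (1999), §2 p. 54, §7 Thm. 7.1.
-/

noncomputable section

namespace Summit.HodgeConjecture.CorCM

open NumberField
open Literature.AlgebraicGeometry.Motives (AbelianVariety CMType IsSmoothProjective)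
open Literature.AlgebraicGeometry.Motives
open Literature.AlgebraicGeometry.HodgeTheory
open Literature.AlgebraicGeometry.Milne1999 (IsOfCMType)
open Literature.AlgebraicGeometry.ComplexMultiplication (IsCMTypeRealisation cmAbelianVarietyRealised_of_riemann)
open Literature.AlgebraicGeometry.Pohlmann1968
open Literature.Barriers.HodgeConjecture (divisorClassesSpan)
open Literature.NumberTheory.Automorphic.PicardCM (eigenline ncard_cmType)

/-! ### Codimension two: Lenstra's simple CM `8`-folds of type `(ℚ(ζ₃₂); Φ′)` -/

/-- **A binder value of `HC_CM` with `B² ≠ D²` — hypothesis-free.**  There is a complex abelian variety `A`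
satisfying BOTH hypotheses of `HC_CM` verbatim (`IsSmoothProjective A.dim A.X`, `IsOfCMType A`) which is SIMPLE,
of dimension `8`, and carries a rational class of Hodge type `(2,2)` in `H⁴(A(ℂ); ℂ)` outside the span of products
of two divisor classes: any realisation of Lenstra's degenerate CM type `Φ′` on `ℚ(ζ₃₂)` (lit-pohlmann:
`Cyclotomic.isSimple_Φ32'`, `Cyclotomic.dim_eq_eight`, `Cyclotomic.exists_exceptional_Φ32'` — Weil classes of
`(A, ℚ(ζ₈))`, multiplicities `(2,2)`), which exists by Riemann's theorem (`cmAbelianVarietyRealised_of_riemann`);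
`IsOfCMType A` by `IsCMTypeRealisation.isOfCMType`, `IsSmoothProjective A.dim A.X` by
`AbelianVariety.isSmoothProjective_holds`. [cite: Gordon1999HodgeAVSurvey, §9.4.2 and 5.13 (ii)]
[cite: Pohlmann1968, Thm. 1 and §3] [cite: Shimura1998, §6.2 Theorem 3 and §8.2 Prop. 26] -/
theorem exists_hc_cm_binders_exceptional_codim_two :
    ∃ A : AbelianVariety ℂ, IsSmoothProjective A.dim A.X ∧ IsOfCMType A ∧ A.IsSimple ∧ A.dim = 8 ∧
      ∃ c : complexBetti A.X (2 * 2), IsRationalClass c ∧ IsOfHodgeType A.dim A.X (2 * 2) 2 2 c ∧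
        c ∉ divisorClassesSpan A.X A.dim 2 := by
  haveI : IsCyclotomicExtension {32} ℚ (CyclotomicField 32 ℚ) := CyclotomicField.isCyclotomicExtension 32 ℚ
  haveI : NumberField (CyclotomicField 32 ℚ) := IsCyclotomicExtension.numberField {32} ℚ _
  haveI : IsCMField (CyclotomicField 32 ℚ) :=
    IsCyclotomicExtension.Rat.isCMField (CyclotomicField 32 ℚ) (S := {32}) ⟨32, rfl, by norm_num⟩
  obtain ⟨A, ι, θ, hA⟩ :=
    cmAbelianVarietyRealised_of_riemann deligneMilne1982_Thm_6_20_full_holds deligneMilne1982_Thm_6_20_essImage_holds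
      (CyclotomicField 32 ℚ) (Cyclotomic.Φ32' _)
  have hA' : IsCMTypeRealisation (Cyclotomic.Φ32' _) A ι θ := hA
  have hdim : A.dim = 8 := Cyclotomic.dim_eq_eight hA'
  refine ⟨A, AbelianVariety.isSmoothProjective_holds, hA'.isOfCMType, Cyclotomic.isSimple_Φ32' hA', hdim, ?_⟩
  rw [hdim]
  exact Cyclotomic.exists_exceptional_Φ32' hA'

/-- **What `HC_CM` asserts in codimension two at that binder value**: `HC_CM` implies that on some simple complex
abelian `8`-fold of CM type a rational `(2,2)`-class outside the span of products of divisor classes lies in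
`algebraicClasses A.X 2` (the span of classes of codimension-`2` algebraic cycles) — the conclusion
`HodgeConjectureFor A.dim A.X` of `HC_CM` applied at the witness of `exists_hc_cm_binders_exceptional_codim_two`.
Nothing is claimed about its truth. [cite: Milne1999, §7 Thm. 7.1] [cite: Gordon1999HodgeAVSurvey, §9.4.2] -/
theorem hc_cm_consequence_codim_two (h : HC_CM) :
    ∃ A : AbelianVariety ℂ, IsOfCMType A ∧ A.IsSimple ∧ A.dim = 8 ∧
      ∃ c : complexBetti A.X (2 * 2), IsRationalClass c ∧ IsOfHodgeType 8 A.X (2 * 2) 2 2 c ∧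
        c ∉ divisorClassesSpan A.X 8 2 ∧ c ∈ algebraicClasses A.X 2 := by
  obtain ⟨A, hsp, hCM, hsimple, hdim, c, hcQ, hcH, hcD⟩ := exists_hc_cm_binders_exceptional_codim_two
  have halg : c ∈ algebraicClasses A.X 2 := (h A hsp hCM).2 2 c hcQ hcH
  rw [hdim] at hcH hcD
  exact ⟨A, hCM, hsimple, hdim, c, hcQ, hcH, hcD, halg⟩

/-! ### Codimension three: the simple CM sixfolds of type `(ℚ(ζ₂₁); Φ₂₁)` -/

/-- **A binder value of `HC_CM` with `B³ ≠ D³` — hypothesis-free.**  There is a complex abelian variety `A`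
satisfying BOTH hypotheses of `HC_CM` verbatim which is SIMPLE, of dimension `6`, and carries a rational class of
Hodge type `(3,3)` in `H⁶(A(ℂ); ℂ)` outside the span of products of three divisor classes: any realisation of the
primitive, degenerate CM type `Φ₂₁` on `ℚ(ζ₂₁)` (lit-pohlmann: `Cyclotomic.isSimple_Φ₂₁`, `Cyclotomic.dim_eq_six`,
`Cyclotomic.exists_exceptional_Φ₂₁` — the Mumford–Pohlmann mechanism for `ℚ(√-3) ⊂ ℚ(ζ₂₁)`, multiplicities
`(3,3)`), which exists by Riemann's theorem. [cite: vanGeemen1994HodgeAV, Thm. 4.5 and 4.7]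
[cite: Pohlmann1968, Thm. 1 and §3] [cite: Shimura1998, §6.2 Theorem 3 and §8.2 Prop. 26] -/
theorem exists_hc_cm_binders_exceptional_codim_three :
    ∃ A : AbelianVariety ℂ, IsSmoothProjective A.dim A.X ∧ IsOfCMType A ∧ A.IsSimple ∧ A.dim = 6 ∧
      ∃ c : complexBetti A.X (2 * 3), IsRationalClass c ∧ IsOfHodgeType A.dim A.X (2 * 3) 3 3 c ∧
        c ∉ divisorClassesSpan A.X A.dim 3 := by
  haveI : IsCyclotomicExtension {21} ℚ (CyclotomicField 21 ℚ) := CyclotomicField.isCyclotomicExtension 21 ℚ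
  haveI : NumberField (CyclotomicField 21 ℚ) := IsCyclotomicExtension.numberField {21} ℚ _
  haveI : IsCMField (CyclotomicField 21 ℚ) :=
    IsCyclotomicExtension.Rat.isCMField (CyclotomicField 21 ℚ) (S := {21}) ⟨21, rfl, by norm_num⟩
  obtain ⟨A, ι, θ, hA⟩ :=
    cmAbelianVarietyRealised_of_riemann deligneMilne1982_Thm_6_20_full_holds deligneMilne1982_Thm_6_20_essImage_holds
      (CyclotomicField 21 ℚ) (Cyclotomic.Φ₂₁ _)
  have hA' : IsCMTypeRealisation (Cyclotomic.Φ₂₁ _) A ι θ := hA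
  have hdim : A.dim = 6 := Cyclotomic.dim_eq_six hA'
  refine ⟨A, AbelianVariety.isSmoothProjective_holds, hA'.isOfCMType, Cyclotomic.isSimple_Φ₂₁ hA', hdim, ?_⟩
  rw [hdim]
  exact Cyclotomic.exists_exceptional_Φ₂₁ hA'

/-- **What `HC_CM` asserts in codimension three at that binder value**: `HC_CM` implies that on some simple complex
abelian sixfold of CM type a rational `(3,3)`-class outside the span of products of divisor classes lies in
`algebraicClasses A.X 3`.  Nothing is claimed about its truth. [cite: Milne1999, §7 Thm. 7.1]
[cite: vanGeemen1994HodgeAV, Thm. 4.5 and 4.7] -/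
theorem hc_cm_consequence_codim_three (h : HC_CM) :
    ∃ A : AbelianVariety ℂ, IsOfCMType A ∧ A.IsSimple ∧ A.dim = 6 ∧
      ∃ c : complexBetti A.X (2 * 3), IsRationalClass c ∧ IsOfHodgeType 6 A.X (2 * 3) 3 3 c ∧
        c ∉ divisorClassesSpan A.X 6 3 ∧ c ∈ algebraicClasses A.X 3 := by
  obtain ⟨A, hsp, hCM, hsimple, hdim, c, hcQ, hcH, hcD⟩ := exists_hc_cm_binders_exceptional_codim_three
  have halg : c ∈ algebraicClasses A.X 3 := (h A hsp hCM).2 3 c hcQ hcH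
  rw [hdim] at hcH hcD
  exact ⟨A, hCM, hsimple, hdim, c, hcQ, hcH, hcD, halg⟩

/-! ### The conclusion is a PROPER constraint at the same binder values (seat b27 gen 17, 2026-08-21)

Lane VAC-C (ii), for the auditors' check (5).  The two facts above leave one «cheap reason» on the conclusion side:
the target's conclusion `c ∈ algebraicClasses A.X p` (`= Nᵖ H²ᵖ(A(ℂ); ℂ)`, Grothendieck's coniveau) could be
automatic at the exhibited binder values — e.g. if `algebraicClasses A.X p = ⊤` there, or if every RATIONAL class of
degree `2p` were algebraic regardless of its Hodge type.  The theorems below certify in the kernel, hypothesis-free,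
that this is not so: on every realisation of a CM type `(K; Φ)` with `2p ≤ g = [K:ℚ]/2`, `p ≠ 0`, the cup monomial
on `2p` eigenvectors of type `(1,0)` is a non-zero class of type `(2p, 0)` (`Pohlmann1968.exists_monomialBasis`,
`isOfHodgeType_monomial` over Deligne's eigenbasis `Deligne1982.exists_eigenbasis_of_isCMTypeRealisation`), hence
NOT of type `(p,p)` (`IsOfHodgeType.eq_zero_of_ne`); rational classes spanning `H²ᵖ(A(ℂ); ℂ)`
(`exists_basis_isRationalClass`), some RATIONAL class is not of type `(p,p)`, hence NOT algebraic — algebraic classes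
being of type `(p,p)` (`isOfHodgeType_of_mem_algebraicClasses_of_isSmoothProjective`, Voisin Prop. 11.20).  At the
Lenstra `8`-fold and the `Φ₂₁` sixfold this gives, next to the exceptional class `c ∉ Dᵖ` which `HC_CM` says is
algebraic, a rational class `c'` of the same degree which is PROVABLY not algebraic: `algebraicClasses A.X p ≠ ⊤`,
and the cycle clause of `HC_CM` with its Hodge-type hypothesis deleted is FALSE at an inhabited binder value (the
clause is load-bearing).  Nothing here is a verdict on `HC_CM`; these are kernel inputs.

* [VoisinHodgeI2002] C. Voisin, *Hodge Theory and Complex Algebraic Geometry I* (2002), Cor. 6.14, §7.1.1,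
  Prop. 11.20, §11.3.1.
* [LangeBirkenhake1992] H. Lange, Ch. Birkenhake, *Complex Abelian Varieties* (1992), Lemma 1.1.17, Thm. 1.4.1 (c).
* [Deligne1982HodgeCycles] P. Deligne, *Hodge cycles on abelian varieties*, LNM 900 (1982), §4 p. 32 and Example 3.7.
-/

/-- **Rational classes off a Hodge type exist as soon as some class is off it** (`X` smooth projective): if some
`e ∈ Hᵏ(X(ℂ); ℂ)` is not of type `(p, q)`, then some RATIONAL class of degree `k` is not of type `(p, q)` — rational
classes span `Hᵏ(X(ℂ); ℂ)` over `ℂ` (`exists_basis_isRationalClass`) and the classes of type `(p, q)` form a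
`ℂ`-subspace (`IsOfHodgeType.zero/add/smul`, one Hodge model by `nonempty_hodgeModel_holds`).
[cite: VoisinHodgeI2002, §7.1.1 and Cor. 6.14] -/
theorem exists_isRationalClass_not_isOfHodgeType_of_not {n : ℕ} {X : SchemeOver ℂ}
    (hX : IsSmoothProjective n X) {k p q : ℕ} {e : complexBetti X k} (he : ¬ IsOfHodgeType n X k p q e) :
    ∃ c : complexBetti X k, IsRationalClass c ∧ ¬ IsOfHodgeType n X k p q c := by
  by_contra hall
  push Not at hall
  obtain ⟨M⟩ := (nonempty_hodgeModel_holds (n := n) (X := X)) hX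
  obtain ⟨r, β, hβ⟩ := exists_basis_isRationalClass hX k
  apply he
  have hmem : e ∈ Submodule.span ℂ (Set.range β) := by rw [β.span_eq]; exact Submodule.mem_top
  refine Submodule.span_induction (fun x hx ↦ ?_) ?_ (fun x y _ _ hx hy ↦ ?_) (fun a x _ hx ↦ ?_) hmem
  · obtain ⟨i, rfl⟩ := hx
    exact hall _ (hβ i)
  · exact IsOfHodgeType.zero M k p q
  · exact hx.add hX hy
  · exact hx.smul a

/-- **A non-zero class of type `(2p, 0)` on every CM abelian variety with `2p ≤ g`.**  For a realisation
`(A, ι, θ)` of a CM type `(K; Φ)`, `g = [K:ℚ]/2 = |Φ|` (`PicardCM.ncard_cmType`), and `2p ≤ g`: in Deligne's eigenbasis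
`(v_σ)_{σ : K → ℂ}` of `H¹(A(ℂ); ℂ)` (`Deligne1982.exists_eigenbasis_of_isCMTypeRealisation`; `v_σ` of type `(1,0)` for
`σ ∈ Φ`, `(0,1)` for `σ ∉ Φ`, by `IsCMTypeRealisation`) the cup monomial `v_t = ∧_{σ ∈ t} v_σ` on a `2p`-subset `t ⊆ Φ`
is a BASIS vector of `H²ᵖ(A(ℂ); ℂ) = ⋀²ᵖ H¹` (`Pohlmann1968.exists_monomialBasis`, Lange–Birkenhake Lemma 1.1.17), hence
non-zero, and of type `(|t ∩ Φ|, |t ∖ Φ|) = (2p, 0)` (`Pohlmann1968.isOfHodgeType_monomial`).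
[cite: LangeBirkenhake1992, Lemma 1.1.17 and Thm. 1.4.1 (c)] [cite: Deligne1982HodgeCycles, §4 p. 32] -/
theorem exists_ne_zero_isOfHodgeType_twoMul_zero_of_isCMTypeRealisation
    {K : Type} [Field K] [NumberField K] {Φ : CMType K} {A : AbelianVariety ℂ}
    {ι : 𝓞 K →+* CategoryTheory.End A} {θ : K →+* Module.End ℂ (complexBetti A.X 1)}
    (hA : IsCMTypeRealisation Φ A ι θ) {p : ℕ} (h2p : 2 * p ≤ Module.finrank ℚ K / 2) :
    ∃ e : complexBetti A.X (2 * p), e ≠ 0 ∧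
      IsOfHodgeType (Module.finrank ℚ K / 2) A.X (2 * p) (2 * p) 0 e := by
  classical
  have hX : IsSmoothProjective (Module.finrank ℚ K / 2) A.X := hA.1
  -- (1) an eigenbasis of `H¹`, of Hodge types `(1,0)` on `Φ` and `(0,1)` off `Φ`
  obtain ⟨v, hv, -⟩ :=
    Literature.AlgebraicGeometry.Deligne1982.exists_eigenbasis_of_isCMTypeRealisation hA
  have hvl : ∀ σ, v σ ∈ eigenline θ σ := fun σ =>
    (Submodule.mem_iInf _).2 fun a => Module.End.mem_eigenspace_iff.2 (hv σ a)
  have hv10 : ∀ σ, (fun σ : K →+* ℂ => σ ∈ Φ.1) σ →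
      IsOfHodgeType (Module.finrank ℚ K / 2) A.X 1 1 0 (v σ) :=
    fun σ hσ => (hA.2.2.2 σ).2.1 hσ (v σ) (hvl σ)
  have hv01 : ∀ σ, ¬ (fun σ : K →+* ℂ => σ ∈ Φ.1) σ →
      IsOfHodgeType (Module.finrank ℚ K / 2) A.X 1 0 1 (v σ) :=
    fun σ hσ => (hA.2.2.2 σ).2.2 hσ (v σ) (hvl σ)
  -- (2) the cup-monomial basis of `H^{2p} = ⋀^{2p} H¹`
  letI : LinearOrder (K →+* ℂ) :=
    LinearOrder.lift' (Fintype.equivFin (K →+* ℂ)) (Fintype.equivFin (K →+* ℂ)).injective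
  obtain ⟨b, hb⟩ := exists_monomialBasis v (2 * p)
  -- (3) a `2p`-subset `t ⊆ Φ` (`|Φ| = g ≥ 2p`)
  have hcard : 2 * p ≤ Φ.1.toFinset.card := by
    rw [← Set.ncard_eq_toFinset_card' Φ.1, ncard_cmType Φ]; exact h2p
  obtain ⟨t, htΦ, htcard⟩ := Finset.exists_subset_card_eq hcard
  let s : Set.powersetCard (K →+* ℂ) (2 * p) := Set.powersetCard.ofCard htcard
  have hst : (s : Finset (K →+* ℂ)) = t := rfl
  refine ⟨b s, b.ne_zero s, ?_⟩
  -- (4) the monomial `v_t` has type `(|t ∩ Φ|, |t ∖ Φ|) = (2p, 0)`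
  have h := isOfHodgeType_monomial hX hb (fun σ : K →+* ℂ => σ ∈ Φ.1) hv10 hv01 s
  have h1 : {i | i ∈ (s : Finset (K →+* ℂ)) ∧ i ∈ Φ.1}.ncard = 2 * p := by
    have : {i | i ∈ (s : Finset (K →+* ℂ)) ∧ i ∈ Φ.1} = ↑t := by
      ext i
      simp only [Set.mem_setOf_eq, hst, Finset.mem_coe]
      exact ⟨fun h => h.1, fun h => ⟨h, by simpa using htΦ h⟩⟩
    rw [this, Set.ncard_coe_finset, htcard]
  have h0 : {i | i ∈ (s : Finset (K →+* ℂ)) ∧ i ∉ Φ.1}.ncard = 0 := by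
    have : {i | i ∈ (s : Finset (K →+* ℂ)) ∧ i ∉ Φ.1} = ∅ := by
      ext i
      simp only [Set.mem_setOf_eq, hst, Set.mem_empty_iff_false, iff_false, not_and, not_not]
      intro hi
      simpa using htΦ hi
    rw [this, Set.ncard_empty]
  rw [h1, h0] at h
  exact h

/-- **On every CM abelian variety with `2 ≤ 2p ≤ g` some RATIONAL class of degree `2p` is NOT of type `(p,p)`,
hence NOT algebraic.**  The non-zero `(2p,0)`-class of
`exists_ne_zero_isOfHodgeType_twoMul_zero_of_isCMTypeRealisation` is not of type `(p,p)` (`(2p,0) ≠ (p,p)` for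
`p ≠ 0`; a class of two distinct types vanishes, `IsOfHodgeType.eq_zero_of_ne`); so a rational class off type `(p,p)`
exists (`exists_isRationalClass_not_isOfHodgeType_of_not`), and it lies outside `algebraicClasses A.X p = Nᵖ H²ᵖ`,
whose members are of type `(p,p)` (`isOfHodgeType_of_mem_algebraicClasses_of_isSmoothProjective`).
[cite: VoisinHodgeI2002, Cor. 6.14 and Prop. 11.20] [cite: LangeBirkenhake1992, Thm. 1.4.1 (c)] -/
theorem exists_isRationalClass_not_mem_algebraicClasses_of_isCMTypeRealisation
    {K : Type} [Field K] [NumberField K] {Φ : CMType K} {A : AbelianVariety ℂ}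
    {ι : 𝓞 K →+* CategoryTheory.End A} {θ : K →+* Module.End ℂ (complexBetti A.X 1)}
    (hA : IsCMTypeRealisation Φ A ι θ) {p : ℕ} (hp : p ≠ 0) (h2p : 2 * p ≤ Module.finrank ℚ K / 2) :
    ∃ c : complexBetti A.X (2 * p), IsRationalClass c ∧
      ¬ IsOfHodgeType (Module.finrank ℚ K / 2) A.X (2 * p) p p c ∧ c ∉ algebraicClasses A.X p := by
  have hX : IsSmoothProjective (Module.finrank ℚ K / 2) A.X := hA.1
  obtain ⟨e, hne, he⟩ := exists_ne_zero_isOfHodgeType_twoMul_zero_of_isCMTypeRealisation hA h2p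
  have hepp : ¬ IsOfHodgeType (Module.finrank ℚ K / 2) A.X (2 * p) p p e := fun hpp =>
    hne (he.eq_zero_of_ne hX hpp (by intro h; simp only [Prod.mk.injEq] at h; omega))
  obtain ⟨c, hc, hcpp⟩ := exists_isRationalClass_not_isOfHodgeType_of_not hX hepp
  exact ⟨c, hc, hcpp, fun halg =>
    hcpp (isOfHodgeType_of_mem_algebraicClasses_of_isSmoothProjective hX p halg)⟩

/-- **Codimension two, both sides of the conclusion at ONE binder value — hypothesis-free.**  There is a complex
abelian variety `A` meeting BOTH hypotheses of `HC_CM` verbatim (`IsSmoothProjective A.dim A.X`, `IsOfCMType A`),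
SIMPLE of dimension `8` (Lenstra's `Φ′` on `ℚ(ζ₃₂)`, by Riemann's theorem), carrying in `H⁴(A(ℂ); ℂ)`
(i) a rational `(2,2)`-class `c ∉ D²(A)` (`Cyclotomic.exists_exceptional_Φ32'`) — which `HC_CM` asserts to be
algebraic — AND (ii) a rational class `c'` NOT of type `(2,2)` and NOT in `algebraicClasses A.X 2`
(`exists_isRationalClass_not_mem_algebraicClasses_of_isCMTypeRealisation`, `2·2 ≤ 8`): the conclusion predicate of
`HC_CM` is a proper subspace of `H⁴` separating rational classes at this binder value.
[cite: Gordon1999HodgeAVSurvey, §9.4.2 and 5.13 (ii)] [cite: VoisinHodgeI2002, Prop. 11.20]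
[cite: Shimura1998, §6.2 Theorem 3 and §8.2 Prop. 26] -/
theorem exists_hc_cm_binders_proper_codim_two :
    ∃ A : AbelianVariety ℂ, IsSmoothProjective A.dim A.X ∧ IsOfCMType A ∧ A.IsSimple ∧ A.dim = 8 ∧
      (∃ c : complexBetti A.X (2 * 2), IsRationalClass c ∧ IsOfHodgeType A.dim A.X (2 * 2) 2 2 c ∧
        c ∉ divisorClassesSpan A.X A.dim 2) ∧
      ∃ c' : complexBetti A.X (2 * 2), IsRationalClass c' ∧ ¬ IsOfHodgeType A.dim A.X (2 * 2) 2 2 c' ∧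
        c' ∉ algebraicClasses A.X 2 := by
  haveI : IsCyclotomicExtension {32} ℚ (CyclotomicField 32 ℚ) := CyclotomicField.isCyclotomicExtension 32 ℚ
  haveI : NumberField (CyclotomicField 32 ℚ) := IsCyclotomicExtension.numberField {32} ℚ _
  haveI : IsCMField (CyclotomicField 32 ℚ) :=
    IsCyclotomicExtension.Rat.isCMField (CyclotomicField 32 ℚ) (S := {32}) ⟨32, rfl, by norm_num⟩
  obtain ⟨A, ι, θ, hA⟩ :=
    cmAbelianVarietyRealised_of_riemann deligneMilne1982_Thm_6_20_full_holds deligneMilne1982_Thm_6_20_essImage_holds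
      (CyclotomicField 32 ℚ) (Cyclotomic.Φ32' _)
  have hA' : IsCMTypeRealisation (Cyclotomic.Φ32' _) A ι θ := hA
  have hdim : A.dim = 8 := Cyclotomic.dim_eq_eight hA'
  have hg : Module.finrank ℚ (CyclotomicField 32 ℚ) / 2 = A.dim := (schemeDim_eq_holds hA'.1).symm
  refine ⟨A, AbelianVariety.isSmoothProjective_holds, hA'.isOfCMType, Cyclotomic.isSimple_Φ32' hA', hdim, ?_, ?_⟩
  · rw [hdim]
    exact Cyclotomic.exists_exceptional_Φ32' hA'
  · rw [← hg]
    exact exists_isRationalClass_not_mem_algebraicClasses_of_isCMTypeRealisation hA' two_ne_zero (by omega)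

/-- **The Hodge-type clause of `HC_CM` is load-bearing in codimension two, and `algebraicClasses ≠ ⊤` there —
hypothesis-free.**  At a binder value meeting both hypotheses of `HC_CM` (a simple CM abelian `8`-fold), the cycle
clause of `HodgeConjectureFor` with `IsOfHodgeType … 2 2 c` DELETED — «every rational class of degree `4` is
algebraic» — is FALSE, and `algebraicClasses A.X 2` is a proper subspace of `H⁴(A(ℂ); ℂ)`: the rational non-algebraic
class of `exists_hc_cm_binders_proper_codim_two`.  So `HC_CM` is not made true at this binder by an over-large
conclusion predicate, and any proof of it must use the Hodge type of the class. [cite: VoisinHodgeI2002, Prop. 11.20 and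
§11.3.1] -/
theorem hc_cm_cycleClause_false_without_hodgeType_codim_two :
    ∃ A : AbelianVariety ℂ, IsSmoothProjective A.dim A.X ∧ IsOfCMType A ∧ A.IsSimple ∧ A.dim = 8 ∧
      algebraicClasses A.X 2 ≠ ⊤ ∧
      ¬ ∀ c : complexBetti A.X (2 * 2), IsRationalClass c → c ∈ algebraicClasses A.X 2 := by
  obtain ⟨A, hsp, hCM, hsimple, hdim, -, c', hc'Q, -, hc'alg⟩ := exists_hc_cm_binders_proper_codim_two
  exact ⟨A, hsp, hCM, hsimple, hdim, fun htop => hc'alg (htop ▸ Submodule.mem_top),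
    fun hall => hc'alg (hall c' hc'Q)⟩

/-- **Codimension three, both sides of the conclusion at ONE binder value — hypothesis-free.**  A complex abelian
variety `A` meeting BOTH hypotheses of `HC_CM` verbatim, SIMPLE of dimension `6` (the type `Φ₂₁` on `ℚ(ζ₂₁)`),
carrying in `H⁶(A(ℂ); ℂ)` (i) a rational `(3,3)`-class `c ∉ D³(A)` (`Cyclotomic.exists_exceptional_Φ₂₁`) AND (ii) a
rational class `c'` NOT of type `(3,3)` and NOT in `algebraicClasses A.X 3` (`2·3 ≤ 6`: the `(6,0)`-monomial on all of
`Φ₂₁`). [cite: vanGeemen1994HodgeAV, Thm. 4.5 and 4.7] [cite: VoisinHodgeI2002, Prop. 11.20]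
[cite: Shimura1998, §6.2 Theorem 3 and §8.2 Prop. 26] -/
theorem exists_hc_cm_binders_proper_codim_three :
    ∃ A : AbelianVariety ℂ, IsSmoothProjective A.dim A.X ∧ IsOfCMType A ∧ A.IsSimple ∧ A.dim = 6 ∧
      (∃ c : complexBetti A.X (2 * 3), IsRationalClass c ∧ IsOfHodgeType A.dim A.X (2 * 3) 3 3 c ∧
        c ∉ divisorClassesSpan A.X A.dim 3) ∧
      ∃ c' : complexBetti A.X (2 * 3), IsRationalClass c' ∧ ¬ IsOfHodgeType A.dim A.X (2 * 3) 3 3 c' ∧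
        c' ∉ algebraicClasses A.X 3 := by
  haveI : IsCyclotomicExtension {21} ℚ (CyclotomicField 21 ℚ) := CyclotomicField.isCyclotomicExtension 21 ℚ
  haveI : NumberField (CyclotomicField 21 ℚ) := IsCyclotomicExtension.numberField {21} ℚ _
  haveI : IsCMField (CyclotomicField 21 ℚ) :=
    IsCyclotomicExtension.Rat.isCMField (CyclotomicField 21 ℚ) (S := {21}) ⟨21, rfl, by norm_num⟩
  obtain ⟨A, ι, θ, hA⟩ :=
    cmAbelianVarietyRealised_of_riemann deligneMilne1982_Thm_6_20_full_holds deligneMilne1982_Thm_6_20_essImage_holds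
      (CyclotomicField 21 ℚ) (Cyclotomic.Φ₂₁ _)
  have hA' : IsCMTypeRealisation (Cyclotomic.Φ₂₁ _) A ι θ := hA
  have hdim : A.dim = 6 := Cyclotomic.dim_eq_six hA'
  have hg : Module.finrank ℚ (CyclotomicField 21 ℚ) / 2 = A.dim := (schemeDim_eq_holds hA'.1).symm
  refine ⟨A, AbelianVariety.isSmoothProjective_holds, hA'.isOfCMType, Cyclotomic.isSimple_Φ₂₁ hA', hdim, ?_, ?_⟩
  · rw [hdim]
    exact Cyclotomic.exists_exceptional_Φ₂₁ hA'
  · rw [← hg]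
    exact exists_isRationalClass_not_mem_algebraicClasses_of_isCMTypeRealisation hA' three_ne_zero (by omega)

/-- **The Hodge-type clause of `HC_CM` is load-bearing in codimension three, and `algebraicClasses A.X 3 ≠ ⊤`
there — hypothesis-free** (the simple CM sixfold of `exists_hc_cm_binders_proper_codim_three`).
[cite: VoisinHodgeI2002, Prop. 11.20 and §11.3.1] -/
theorem hc_cm_cycleClause_false_without_hodgeType_codim_three :
    ∃ A : AbelianVariety ℂ, IsSmoothProjective A.dim A.X ∧ IsOfCMType A ∧ A.IsSimple ∧ A.dim = 6 ∧
      algebraicClasses A.X 3 ≠ ⊤ ∧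
      ¬ ∀ c : complexBetti A.X (2 * 3), IsRationalClass c → c ∈ algebraicClasses A.X 3 := by
  obtain ⟨A, hsp, hCM, hsimple, hdim, -, c', hc'Q, -, hc'alg⟩ := exists_hc_cm_binders_proper_codim_three
  exact ⟨A, hsp, hCM, hsimple, hdim, fun htop => hc'alg (htop ▸ Submodule.mem_top),
    fun hall => hc'alg (hall c' hc'Q)⟩

end Summit.HodgeConjecture.CorCM

end
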